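import Mathlib
import HarnessLib
import Literature.Analysis.FluidPDE.BeltramiFlows
import Summits.NavierStokesRegularity.FluidComputer.ABCAlphaPointStrain

/-!
# The stagnation skeleton of the ABC 1:1:1 host is COMPLETE: exactly eight zeros per period cell —
# four of type α, four of type β — every one a NON-DEGENERATE pure-strain point
# (instab lane, door O-acc = O7 / obstruction P3: the kernel form of the site detector's null test and of
# `HOME/instab2/HEREDITY-P3.md` (F); cell `ns-blowup`, seat `ns-blowup-instab2`)

HONEST FRAMING (human ruling D-0035): this cell ATTEMPTS the negative direction of the Clay problem; nothing
in this file is a claim about the Navier–Stokes equations. WHAT THIS IS NOT: not dynamics. It is elementary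
trigonometry and `3 × 3` linear algebra on the tree's ABC field
`U = Literature.Analysis.FluidPDE.ABC.abc 1 1 1 = (sin x₂ + cos x₁, sin x₀ + cos x₂, sin x₁ + cos x₀)` (Majda–Bertozzi
(2.49) with `A = B = C = 1`) and its Jacobian `ABC.jac 1 1 1` (row `j` = `∂/∂xⱼ`, column `i` = component), which the
cell's P-TOWER MODEL uses as the level-`k−1` HOST.

## Why the cell wants it
Every instrument of the heredity census locates structures relative to the host's STAGNATION SKELETON: the site
detector's null test reads «8 zeros = 4α + 4β exactly» (`HOME/instab2/SITE-DETECTOR.md`, kit j244758), its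
completeness flag on the generic arm is the signed count `#α − #β = 0` (STATUS PRE-DATA NOTE 2026-08-26 (g1)), its
small-time prior is «8 structurally stable skeleton zeros, displaced but not destroyed» (g2), and HEREDITY-P3 (F)
(`ABCSkeletonSeparation`) speaks of «four lines, each carrying one α-point and one β-point». Until now the tree held
the two DIAGONAL points `α₀ = (7π/4)·𝟙`, `β₀ = (3π/4)·𝟙` (`ABCAlphaPointStrain`) and the four lines; that these eight
points are ALL the zeros was a numerical finding. Here completeness becomes a kernel theorem (and non-degeneracy
with the stated types in the companion `ABCStagnationJacobian`) [classical: Dombre, Frisch, Greene, Hénon, Mehr,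
Soward, J. Fluid Mech. 167 (1986) 353–391, §4 — the `A = B = C` case has exactly eight stagnation points].

## What is proved (Mathlib + `Literature…BeltramiFlows` + `ABCAlphaPointStrain`; no definitions)
* §1 one-coordinate lemmas: `sq_eq_half_iff`, `exists_int_of_sin_eq_of_cos_eq` (`sin x = sin θ ∧ cos x = cos θ ⇒
  x ∈ θ + 2πℤ`), `sin/cos_five_pi_div_four`, the four quadrant lemmas `exists_eq_pi_div_four` …
  `exists_eq_seven_pi_div_four`;
* §2 `abc_eq_zero_iff_eqns` (`U x = 0` ⇔ `sin x₂ = −cos x₁ ∧ sin x₀ = −cos x₂ ∧ sin x₁ = −cos x₀`) and the LATTICE LEMMA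
  `sin_sq_eq_half_of_abc_eq_zero` / `cos_sq_eq_half_of_abc_eq_zero`: at a zero EVERY coordinate has
  `sin² = cos² = ½` (chain `sin²x₂ = cos²x₁ = 1 − sin²x₁ = 1 − cos²x₀ = sin²x₀ = cos²x₂ = 1 − sin²x₂`), i.e. lies on the
  quarter lattice `π/4 + (π/2)ℤ` (`cos_two_mul_eq_zero_of_abc_eq_zero`, `exists_eq_pi_div_four_add_of_abc_eq_zero`);
* §3 the eight representatives are zeros: `abc_alpha1/2/3_eq_zero`, `abc_beta1/2/3_eq_zero` (`α₀`, `β₀` are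
  `ABCAlphaPointStrain.abc_alpha0/beta0_eq_zero`), where `α₁ = π(3,1,5)/4`, `α₂ = π(5,3,1)/4`, `α₃ = π(1,5,3)/4`,
  `β₁ = π(7,5,1)/4`, `β₂ = π(1,7,5)/4`, `β₃ = π(5,1,7)/4` (`βᵢ ≡ αᵢ + π dᵢ` on the line `Lᵢ` of `ABCSkeletonSeparation`,
  `dᵢ ∈ {(1,1,1), (1,−1,−1), (−1,1,−1), (−1,−1,1)}`);
* §4 COMPLETENESS `abc_eq_zero_iff`: `U x = 0` ⇔ `x ≡` one of these eight points `mod 2πℤ³` — exactly EIGHT stagnation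
  points per period cell `[0, 2π)³`. (`⇒`: the lattice lemma leaves the signs of `sin x₀, cos x₀, cos x₁` free — eight
  choices — and the equations fix `sin x₁ = −cos x₀`, `sin x₂ = −cos x₁`, `cos x₂ = −sin x₀`; each choice is one point.)
The Jacobian at the eight zeros (symmetric, `(det ∇U)² = ½` — all NON-DEGENERATE —, type `α`/`β` by the sign of
`det ∇U = −2 sin x₀ sin x₁ sin x₂`, strain rates `(±√2, ∓√2/2, ∓√2/2)`) is the companion file `ABCStagnationJacobian`.
LABEL: MODEL-door kinematics (the host's skeleton). WHAT THIS IS NOT: not NS; no flow is evolved.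
-/

namespace Summit.NavierStokesRegularity.FluidComputer.ABCStagnationSkeleton

open Real Literature.Analysis.FluidPDE

/-! ## §1 One coordinate: `sin² = cos² = ½` puts an angle on the quarter lattice `π/4 + (π/2)ℤ` -/

/-- `(√2/2)² = ½`. -/
theorem sqrt_two_div_two_sq : (Real.sqrt 2 / 2) ^ 2 = 1 / 2 := by
  rw [div_pow, Real.sq_sqrt (by norm_num : (0:ℝ) ≤ 2)]; norm_num

/-- `t² = ½ ⇔ t = ±√2/2`. -/
theorem sq_eq_half_iff (t : ℝ) : t ^ 2 = 1 / 2 ↔ t = Real.sqrt 2 / 2 ∨ t = -(Real.sqrt 2 / 2) := by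
  have h := sqrt_two_div_two_sq
  constructor
  · intro ht
    have e : (t - Real.sqrt 2 / 2) * (t + Real.sqrt 2 / 2) = t ^ 2 - (Real.sqrt 2 / 2) ^ 2 := by ring
    rw [ht, h, sub_self] at e
    rcases mul_eq_zero.1 e with h1 | h1
    · left; linarith
    · right; linarith
  · rintro (rfl | rfl)
    · exact h
    · rw [neg_sq]; exact h

/-- If `sin x = sin θ` and `cos x = cos θ` then `x ≡ θ (mod 2π)`: `cos (x − θ) = cos²θ + sin²θ = 1`. -/
theorem exists_int_of_sin_eq_of_cos_eq {x θ : ℝ} (hs : Real.sin x = Real.sin θ) (hc : Real.cos x = Real.cos θ) :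
    ∃ n : ℤ, x = θ + n * (2 * π) := by
  have h1 : Real.cos (x - θ) = 1 := by
    rw [Real.cos_sub, hs, hc]; nlinarith [Real.sin_sq_add_cos_sq θ]
  obtain ⟨n, hn⟩ := (Real.cos_eq_one_iff (x - θ)).1 h1
  exact ⟨n, by linarith⟩

/-- `sin(5π/4) = −√2/2`. -/
theorem sin_five_pi_div_four : Real.sin (5 * π / 4) = -(Real.sqrt 2 / 2) := by
  have h : 5 * π / 4 = π / 4 + π := by ring
  rw [h, Real.sin_add_pi, Real.sin_pi_div_four]

/-- `cos(5π/4) = −√2/2`. -/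
theorem cos_five_pi_div_four : Real.cos (5 * π / 4) = -(Real.sqrt 2 / 2) := by
  have h : 5 * π / 4 = π / 4 + π := by ring
  rw [h, Real.cos_add_pi, Real.cos_pi_div_four]

/-- Quadrant I: `sin x = cos x = √2/2 ⇒ x ∈ π/4 + 2πℤ`. -/
theorem exists_eq_pi_div_four {x : ℝ} (hs : Real.sin x = Real.sqrt 2 / 2) (hc : Real.cos x = Real.sqrt 2 / 2) :
    ∃ n : ℤ, x = π / 4 + n * (2 * π) :=
  exists_int_of_sin_eq_of_cos_eq (hs.trans Real.sin_pi_div_four.symm) (hc.trans Real.cos_pi_div_four.symm)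

/-- Quadrant II: `sin x = √2/2`, `cos x = −√2/2 ⇒ x ∈ 3π/4 + 2πℤ`. -/
theorem exists_eq_three_pi_div_four {x : ℝ} (hs : Real.sin x = Real.sqrt 2 / 2)
    (hc : Real.cos x = -(Real.sqrt 2 / 2)) : ∃ n : ℤ, x = 3 * π / 4 + n * (2 * π) :=
  exists_int_of_sin_eq_of_cos_eq (hs.trans ABCAlphaPointStrain.sin_three_pi_div_four.symm)
    (hc.trans ABCAlphaPointStrain.cos_three_pi_div_four.symm)

/-- Quadrant III: `sin x = cos x = −√2/2 ⇒ x ∈ 5π/4 + 2πℤ`. -/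
theorem exists_eq_five_pi_div_four {x : ℝ} (hs : Real.sin x = -(Real.sqrt 2 / 2))
    (hc : Real.cos x = -(Real.sqrt 2 / 2)) : ∃ n : ℤ, x = 5 * π / 4 + n * (2 * π) :=
  exists_int_of_sin_eq_of_cos_eq (hs.trans sin_five_pi_div_four.symm) (hc.trans cos_five_pi_div_four.symm)

/-- Quadrant IV: `sin x = −√2/2`, `cos x = √2/2 ⇒ x ∈ 7π/4 + 2πℤ`. -/
theorem exists_eq_seven_pi_div_four {x : ℝ} (hs : Real.sin x = -(Real.sqrt 2 / 2))
    (hc : Real.cos x = Real.sqrt 2 / 2) : ∃ n : ℤ, x = 7 * π / 4 + n * (2 * π) :=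
  exists_int_of_sin_eq_of_cos_eq (hs.trans ABCAlphaPointStrain.sin_seven_pi_div_four.symm)
    (hc.trans ABCAlphaPointStrain.cos_seven_pi_div_four.symm)

/-! ## §2 The stagnation equations and the lattice lemma -/

/-- `U x = 0` ⇔ the three scalar equations `sin x₂ + cos x₁ = 0`, `sin x₀ + cos x₂ = 0`, `sin x₁ + cos x₀ = 0`. -/
theorem abc_eq_zero_iff_eqns (x : EuclideanSpace ℝ (Fin 3)) :
    ABC.abc 1 1 1 x = 0 ↔ Real.sin (x 2) + Real.cos (x 1) = 0 ∧ Real.sin (x 0) + Real.cos (x 2) = 0 ∧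
      Real.sin (x 1) + Real.cos (x 0) = 0 := by
  constructor
  · intro h
    have h0 := congrArg (fun v : EuclideanSpace ℝ (Fin 3) => v 0) h
    have h1 := congrArg (fun v : EuclideanSpace ℝ (Fin 3) => v 1) h
    have h2 := congrArg (fun v : EuclideanSpace ℝ (Fin 3) => v 2) h
    simp only [ABC.abc_apply_zero, ABC.abc_apply_one, ABC.abc_apply_two, one_mul] at h0 h1 h2
    exact ⟨by simpa using h0, by simpa using h1, by simpa using h2⟩
  · rintro ⟨h0, h1, h2⟩
    ext i
    fin_cases i <;> simp [h0, h1, h2]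

/-- LATTICE LEMMA (sines): at a stagnation point `sin² xᵢ = ½` for every coordinate. From the three equations and
`sin² + cos² = 1`: `sin²x₂ = cos²x₁ = 1 − sin²x₁ = 1 − cos²x₀ = sin²x₀ = cos²x₂ = 1 − sin²x₂`. -/
theorem sin_sq_eq_half_of_abc_eq_zero {x : EuclideanSpace ℝ (Fin 3)} (h : ABC.abc 1 1 1 x = 0) (i : Fin 3) :
    Real.sin (x i) ^ 2 = 1 / 2 := by
  obtain ⟨h0, h1, h2⟩ := (abc_eq_zero_iff_eqns x).1 h
  have e0 := Real.sin_sq_add_cos_sq (x 0)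
  have e1 := Real.sin_sq_add_cos_sq (x 1)
  have e2 := Real.sin_sq_add_cos_sq (x 2)
  have a2 : Real.sin (x 2) = -Real.cos (x 1) := by linarith
  have a0 : Real.sin (x 0) = -Real.cos (x 2) := by linarith
  have a1 : Real.sin (x 1) = -Real.cos (x 0) := by linarith
  have b2 : Real.sin (x 2) ^ 2 = Real.cos (x 1) ^ 2 := by rw [a2, neg_sq]
  have b0 : Real.sin (x 0) ^ 2 = Real.cos (x 2) ^ 2 := by rw [a0, neg_sq]
  have b1 : Real.sin (x 1) ^ 2 = Real.cos (x 0) ^ 2 := by rw [a1, neg_sq]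
  fin_cases i <;> simp <;> linarith

/-- LATTICE LEMMA (cosines): at a stagnation point `cos² xᵢ = ½` for every coordinate. -/
theorem cos_sq_eq_half_of_abc_eq_zero {x : EuclideanSpace ℝ (Fin 3)} (h : ABC.abc 1 1 1 x = 0) (i : Fin 3) :
    Real.cos (x i) ^ 2 = 1 / 2 := by
  have := sin_sq_eq_half_of_abc_eq_zero h i
  nlinarith [Real.sin_sq_add_cos_sq (x i)]

/-- Hence `cos (2xᵢ) = 0`: every coordinate of a stagnation point lies on the quarter lattice `π/4 + (π/2)ℤ`
(`Real.cos_eq_zero_iff`). -/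
theorem cos_two_mul_eq_zero_of_abc_eq_zero {x : EuclideanSpace ℝ (Fin 3)} (h : ABC.abc 1 1 1 x = 0) (i : Fin 3) :
    Real.cos (2 * x i) = 0 := by
  rw [Real.cos_two_mul]
  have := cos_sq_eq_half_of_abc_eq_zero h i
  linarith

/-- The quarter lattice written out: `U x = 0 ⇒ ∃ k, xᵢ = π/4 + k·(π/2)`. -/
theorem exists_eq_pi_div_four_add_of_abc_eq_zero {x : EuclideanSpace ℝ (Fin 3)} (h : ABC.abc 1 1 1 x = 0)
    (i : Fin 3) : ∃ k : ℤ, x i = π / 4 + k * (π / 2) := by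
  obtain ⟨k, hk⟩ := Real.cos_eq_zero_iff.1 (cos_two_mul_eq_zero_of_abc_eq_zero h i)
  exact ⟨k, by linarith⟩

/-! ## §3 The eight representatives are stagnation points -/

/-- `α₁ = π(3/4, 1/4, 5/4)` is a stagnation point. -/
theorem abc_alpha1_eq_zero :
    ABC.abc 1 1 1 (!₂[3 * π / 4, π / 4, 5 * π / 4] : EuclideanSpace ℝ (Fin 3)) = 0 := by
  ext i
  fin_cases i <;> simp [ABC.abc, ABCAlphaPointStrain.sin_three_pi_div_four,
    ABCAlphaPointStrain.cos_three_pi_div_four, sin_five_pi_div_four, cos_five_pi_div_four,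
    Real.sin_pi_div_four, Real.cos_pi_div_four]

/-- `α₂ = π(5/4, 3/4, 1/4)` is a stagnation point. -/
theorem abc_alpha2_eq_zero :
    ABC.abc 1 1 1 (!₂[5 * π / 4, 3 * π / 4, π / 4] : EuclideanSpace ℝ (Fin 3)) = 0 := by
  ext i
  fin_cases i <;> simp [ABC.abc, ABCAlphaPointStrain.sin_three_pi_div_four,
    ABCAlphaPointStrain.cos_three_pi_div_four, sin_five_pi_div_four, cos_five_pi_div_four,
    Real.sin_pi_div_four, Real.cos_pi_div_four]

/-- `α₃ = π(1/4, 5/4, 3/4)` is a stagnation point. -/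
theorem abc_alpha3_eq_zero :
    ABC.abc 1 1 1 (!₂[π / 4, 5 * π / 4, 3 * π / 4] : EuclideanSpace ℝ (Fin 3)) = 0 := by
  ext i
  fin_cases i <;> simp [ABC.abc, ABCAlphaPointStrain.sin_three_pi_div_four,
    ABCAlphaPointStrain.cos_three_pi_div_four, sin_five_pi_div_four, cos_five_pi_div_four,
    Real.sin_pi_div_four, Real.cos_pi_div_four]

/-- `β₁ = π(7/4, 5/4, 1/4)` (`≡ α₁ + π(1,−1,−1)`) is a stagnation point. -/
theorem abc_beta1_eq_zero :
    ABC.abc 1 1 1 (!₂[7 * π / 4, 5 * π / 4, π / 4] : EuclideanSpace ℝ (Fin 3)) = 0 := by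
  ext i
  fin_cases i <;> simp [ABC.abc, ABCAlphaPointStrain.sin_seven_pi_div_four,
    ABCAlphaPointStrain.cos_seven_pi_div_four, sin_five_pi_div_four, cos_five_pi_div_four,
    Real.sin_pi_div_four, Real.cos_pi_div_four]

/-- `β₂ = π(1/4, 7/4, 5/4)` (`≡ α₂ + π(−1,1,−1)`) is a stagnation point. -/
theorem abc_beta2_eq_zero :
    ABC.abc 1 1 1 (!₂[π / 4, 7 * π / 4, 5 * π / 4] : EuclideanSpace ℝ (Fin 3)) = 0 := by
  ext i
  fin_cases i <;> simp [ABC.abc, ABCAlphaPointStrain.sin_seven_pi_div_four,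
    ABCAlphaPointStrain.cos_seven_pi_div_four, sin_five_pi_div_four, cos_five_pi_div_four,
    Real.sin_pi_div_four, Real.cos_pi_div_four]

/-- `β₃ = π(5/4, 1/4, 7/4)` (`≡ α₃ + π(−1,−1,1)`) is a stagnation point. -/
theorem abc_beta3_eq_zero :
    ABC.abc 1 1 1 (!₂[5 * π / 4, π / 4, 7 * π / 4] : EuclideanSpace ℝ (Fin 3)) = 0 := by
  ext i
  fin_cases i <;> simp [ABC.abc, ABCAlphaPointStrain.sin_seven_pi_div_four,
    ABCAlphaPointStrain.cos_seven_pi_div_four, sin_five_pi_div_four, cos_five_pi_div_four,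
    Real.sin_pi_div_four, Real.cos_pi_div_four]

/-! ## §4 COMPLETENESS: the zero set of `U` is the eight points modulo `2πℤ³` -/

/-- **THE STAGNATION SKELETON IS COMPLETE.** `U x = 0` if and only if `x` is congruent modulo `2πℤ³` to one of
the eight points `α₀ = π(7,7,7)/4`, `α₁ = π(3,1,5)/4`, `α₂ = π(5,3,1)/4`, `α₃ = π(1,5,3)/4`, `β₀ = π(3,3,3)/4`,
`β₁ = π(7,5,1)/4`, `β₂ = π(1,7,5)/4`, `β₃ = π(5,1,7)/4` — exactly EIGHT stagnation points per period cell. Proof of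
`⇒`: the lattice lemma gives `sin x₀, cos x₀, cos x₁ ∈ {±√2/2}` (8 sign choices); the three equations then FIX
`sin x₁ = −cos x₀`, `sin x₂ = −cos x₁`, `cos x₂ = −sin x₀`, and each sign choice is one of the eight points by the
quadrant lemmas. [Dombre et al. 1986 §4: «for A = B = C … eight stagnation points».] -/
theorem abc_eq_zero_iff (x : EuclideanSpace ℝ (Fin 3)) :
    ABC.abc 1 1 1 x = 0 ↔ ∃ n : Fin 3 → ℤ,
      (x 0 = 7 * π / 4 + n 0 * (2 * π) ∧ x 1 = 7 * π / 4 + n 1 * (2 * π) ∧ x 2 = 7 * π / 4 + n 2 * (2 * π)) ∨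
      (x 0 = 3 * π / 4 + n 0 * (2 * π) ∧ x 1 = π / 4 + n 1 * (2 * π) ∧ x 2 = 5 * π / 4 + n 2 * (2 * π)) ∨
      (x 0 = 5 * π / 4 + n 0 * (2 * π) ∧ x 1 = 3 * π / 4 + n 1 * (2 * π) ∧ x 2 = π / 4 + n 2 * (2 * π)) ∨
      (x 0 = π / 4 + n 0 * (2 * π) ∧ x 1 = 5 * π / 4 + n 1 * (2 * π) ∧ x 2 = 3 * π / 4 + n 2 * (2 * π)) ∨
      (x 0 = 3 * π / 4 + n 0 * (2 * π) ∧ x 1 = 3 * π / 4 + n 1 * (2 * π) ∧ x 2 = 3 * π / 4 + n 2 * (2 * π)) ∨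
      (x 0 = 7 * π / 4 + n 0 * (2 * π) ∧ x 1 = 5 * π / 4 + n 1 * (2 * π) ∧ x 2 = π / 4 + n 2 * (2 * π)) ∨
      (x 0 = π / 4 + n 0 * (2 * π) ∧ x 1 = 7 * π / 4 + n 1 * (2 * π) ∧ x 2 = 5 * π / 4 + n 2 * (2 * π)) ∨
      (x 0 = 5 * π / 4 + n 0 * (2 * π) ∧ x 1 = π / 4 + n 1 * (2 * π) ∧ x 2 = 7 * π / 4 + n 2 * (2 * π)) := by
  constructor
  · intro h
    obtain ⟨h0, h1, h2⟩ := (abc_eq_zero_iff_eqns x).1 h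
    have hs0 := (sq_eq_half_iff _).1 (sin_sq_eq_half_of_abc_eq_zero h 0)
    have hc0 := (sq_eq_half_iff _).1 (cos_sq_eq_half_of_abc_eq_zero h 0)
    have hc1 := (sq_eq_half_iff _).1 (cos_sq_eq_half_of_abc_eq_zero h 1)
    have a1 : Real.sin (x 1) = -Real.cos (x 0) := by linarith
    have a2 : Real.sin (x 2) = -Real.cos (x 1) := by linarith
    have b2 : Real.cos (x 2) = -Real.sin (x 0) := by linarith
    rcases hs0 with s0 | s0 <;> rcases hc0 with c0 | c0 <;> rcases hc1 with c1 | c1 <;>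
      simp only [s0, c0, c1, neg_neg] at a1 a2 b2
    · -- (+,+ | s1 = −, c1 = + | s2 = −, c2 = −): x = (π/4, 7π/4, 5π/4) = β₂
      obtain ⟨n0, e0⟩ := exists_eq_pi_div_four s0 c0
      obtain ⟨n1, e1⟩ := exists_eq_seven_pi_div_four a1 c1
      obtain ⟨n2, e2⟩ := exists_eq_five_pi_div_four a2 b2
      exact ⟨![n0, n1, n2], by simp [e0, e1, e2]⟩
    · -- (+,+ | −,− | +,−): x = (π/4, 5π/4, 3π/4) = α₃
      obtain ⟨n0, e0⟩ := exists_eq_pi_div_four s0 c0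
      obtain ⟨n1, e1⟩ := exists_eq_five_pi_div_four a1 c1
      obtain ⟨n2, e2⟩ := exists_eq_three_pi_div_four a2 b2
      exact ⟨![n0, n1, n2], by simp [e0, e1, e2]⟩
    · -- (+,− | +,+ | −,−): x = (3π/4, π/4, 5π/4) = α₁
      obtain ⟨n0, e0⟩ := exists_eq_three_pi_div_four s0 c0
      obtain ⟨n1, e1⟩ := exists_eq_pi_div_four a1 c1
      obtain ⟨n2, e2⟩ := exists_eq_five_pi_div_four a2 b2
      exact ⟨![n0, n1, n2], by simp [e0, e1, e2]⟩
    · -- (+,− | +,− | +,−): x = (3π/4, 3π/4, 3π/4) = β₀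
      obtain ⟨n0, e0⟩ := exists_eq_three_pi_div_four s0 c0
      obtain ⟨n1, e1⟩ := exists_eq_three_pi_div_four a1 c1
      obtain ⟨n2, e2⟩ := exists_eq_three_pi_div_four a2 b2
      exact ⟨![n0, n1, n2], by simp [e0, e1, e2]⟩
    · -- (−,+ | −,+ | −,+): x = (7π/4, 7π/4, 7π/4) = α₀
      obtain ⟨n0, e0⟩ := exists_eq_seven_pi_div_four s0 c0
      obtain ⟨n1, e1⟩ := exists_eq_seven_pi_div_four a1 c1
      obtain ⟨n2, e2⟩ := exists_eq_seven_pi_div_four a2 b2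
      exact ⟨![n0, n1, n2], by simp [e0, e1, e2]⟩
    · -- (−,+ | −,− | +,+): x = (7π/4, 5π/4, π/4) = β₁
      obtain ⟨n0, e0⟩ := exists_eq_seven_pi_div_four s0 c0
      obtain ⟨n1, e1⟩ := exists_eq_five_pi_div_four a1 c1
      obtain ⟨n2, e2⟩ := exists_eq_pi_div_four a2 b2
      exact ⟨![n0, n1, n2], by simp [e0, e1, e2]⟩
    · -- (−,− | +,+ | −,+): x = (5π/4, π/4, 7π/4) = β₃
      obtain ⟨n0, e0⟩ := exists_eq_five_pi_div_four s0 c0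
      obtain ⟨n1, e1⟩ := exists_eq_pi_div_four a1 c1
      obtain ⟨n2, e2⟩ := exists_eq_seven_pi_div_four a2 b2
      exact ⟨![n0, n1, n2], by simp [e0, e1, e2]⟩
    · -- (−,− | +,− | +,+): x = (5π/4, 3π/4, π/4) = α₂
      obtain ⟨n0, e0⟩ := exists_eq_five_pi_div_four s0 c0
      obtain ⟨n1, e1⟩ := exists_eq_three_pi_div_four a1 c1
      obtain ⟨n2, e2⟩ := exists_eq_pi_div_four a2 b2
      exact ⟨![n0, n1, n2], by simp [e0, e1, e2]⟩
  · rintro ⟨n, hx | hx | hx | hx | hx | hx | hx | hx⟩ <;> obtain ⟨e0, e1, e2⟩ := hx <;>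
      rw [abc_eq_zero_iff_eqns, e0, e1, e2] <;>
      simp only [Real.sin_add_int_mul_two_pi, Real.cos_add_int_mul_two_pi, Real.sin_pi_div_four,
        Real.cos_pi_div_four, ABCAlphaPointStrain.sin_three_pi_div_four,
        ABCAlphaPointStrain.cos_three_pi_div_four, sin_five_pi_div_four, cos_five_pi_div_four,
        ABCAlphaPointStrain.sin_seven_pi_div_four, ABCAlphaPointStrain.cos_seven_pi_div_four] <;>
      norm_num

end Summit.NavierStokesRegularity.FluidComputer.ABCStagnationSkeleton
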